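import Summits.HodgeConjecture.HodgeConjecture.Theses.FiniteTreeOfFlavours

/-!
# Route FiniteTreeOfFlavours — `HypersurfaceHodgeFromCruxes` (glue item stmt-HodgeConjecture-14377)

`MovableClassesAlgebraic → RigidImpliesQbar → RigidQbarClassesAlgebraic → HodgeModelsExist →
HypersurfaceHodge`: for a smooth hypersurface, Hodge models come from `HodgeModelsExist`, and a
rational `(k, k)`-class is algebraic by the movable/rigid dichotomy — movable classes by
`MovableClassesAlgebraic`, rigid ones live on a hypersurface defined over `ℚ̄` (`RigidImpliesQbar`)
where `RigidQbarClassesAlgebraic` applies.  This is the classes-part of the route's deciding theorem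
`closes`, verbatim.  Pure logic; no other import, no named-fact hypothesis, no sorry.
-/

-- `Summit.HodgeConjecture.HodgeConjecture.Theorems` is the mandated namespace (single-problem
-- summit: Problem = Summit), which `linter.dupNamespace` flags on every declaration; the lakefile
-- turns the linter off tree-wide (weak option), restated here so stand-alone elaboration is
-- warning-free too.
set_option linter.dupNamespace false

namespace Summit.HodgeConjecture.HodgeConjecture.Theorems

/-- **Item stmt-HodgeConjecture-14377 (`HypersurfaceHodgeFromCruxes`), route `FiniteTreeOfFlavours`**:
Hodge models from `HodgeModelsExist`, classes by excluded middle on movability (the body of the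
route's `closes`). [cite: Deligne2000, §1] -/
theorem finiteTreeOfFlavours_hypersurfaceHodgeFromCruxes_proof :
    Summit.HodgeConjecture.HodgeConjecture.Theses.FiniteTreeOfFlavours.HypersurfaceHodgeFromCruxes := by
  intro h₃ h₄ h₅ hM n d Y hY
  refine ⟨hM n Y hY.1, fun k c hc hkk ↦ ?_⟩
  exact (Classical.em _).elim (fun hmov ↦ h₃ hY k c hc hkk hmov)
    (fun hrig ↦ h₅ hY (h₄ hY k c hc hkk hrig) k c hc hkk hrig)

end Summit.HodgeConjecture.HodgeConjecture.Theorems
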